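import Summits.ResolutionOfSingularities.ResolutionOfSingularities.Theorems.EquisingularLiftEquisingularLiftNatBoundaryWitnessedCentreCore
import Summits.ResolutionOfSingularities.ResolutionOfSingularities.Theorems.EquisingularLiftEquisingularLiftNatCompleteIntersectionLiftCentre
import Summits.ResolutionOfSingularities.ResolutionOfSingularities.Theorems.EquisingularLiftEquisingularLiftNatTransversalTraceDownstairs
import Summits.ResolutionOfSingularities.ResolutionOfSingularities.Theorems.EquisingularLiftEquisingularLiftNatRegularOfSpecialFibre
import Literature.AlgebraicGeometry.Resolution.CanonicalResolutionSmoothCentre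
import Literature.AlgebraicGeometry.Resolution.PrimeDivisorIdeals
import HarnessLib

/-!
# [OURS · L1 W4.5(b) · EL♮(3) · T23-A″ bricks (A″-1) + (A″-2)] The boundary-witnessed centre `V(𝓔 ⊔ 𝓕)` is REGULAR and `O`-FLAT — with the DIMENSION clause

Crux EL♮(3) = stmt-ResolutionOfSingularities-20148 (child of EL♮ stmt-…-20038; bookkeeping crux `EquisingularLift` stmt-…-15660); T23-A″ = the
boundary-witnessed round (centre `Z = E ∩ F` of two RETAINED members; desk BOOK 2026-08-28T07:38:20Z, first customer `x⁴ + y⁶ + z⁶`); res-L1-w45b-lead-1's SIG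
`L/res-L1-w45b-lead-1/A2prime-BoundaryWitnessedLift.sig.lean` 007c6321fc326192 bricks (A″-1) `isRegular_subscheme_sup_of_trace_crossing` and (A″-2)
`flat_subschemeι_sup_of_trace_crossing`, in the v2 SHAPE fixed by res-L1-w45b-stub-4's ENGINE WORD 2026-08-28T08:04:24Z («let stub-2's file BE v2»):
ONE MORE BINDER `hWdim` — the dimension clause `dim 𝒪_{Z̃,g} + 3 = dim 𝒪_{X,jG g}` at the CLOSED crossing points `g ∈ E ∩ F` only (what the engine's
`TowerFull`/T-DIM prefix supplies); `hW1` GLOBAL (`𝓘⟨E⟩ ⊔ 𝓘⟨F⟩ = 𝓘⟨E ∩ F⟩`, the second clause of `ConeWitness`); `hW2` in the Čech branches' `∀`-stalk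
form; the unused binders of the first sig (`hE3 hF3 hEflat hFflat h𝓔0 h𝓕0 hW3`) DROPPED. Why `hWdim` (res-L1-w45b-stub-2 SIG FLAG 08:00:44Z): (A″-2) is FALSE
as first typed — `𝓔 = (x)`, `𝓕 = (x + ϖ)` in `𝔸³_O` have equal traces, satisfy (W1)(W2)(W3), and `𝓔 ⊔ 𝓕 = (x, ϖ)` is vertical; (W1)+(W2) make
`𝒪_{X,x}/(e, f, ϖ) ≅ 𝒪_{Z̃,g}` regular but say nothing about its dimension, which is exactly (A″-0)'s input. The conclusions are SCHEME-LEVEL, so the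
file GENERISES from the closed special points: every point of the proper `O`-scheme `V(𝓔 ⊔ 𝓕)` (resp. `X`) specialises to a closed point
(`IsClosed.exists_closed_singleton`), closed points lie over `𝔪_O`, regularity generises (`isRegularLocalRing_stalk_of_specializes`) and so does
`ϖ`-torsion-freeness modulo `C_x` (`𝒪_{X,x}` is a localisation of `𝒪_{X,x₀}` and `C_x = C_{x₀}𝒪_{X,x}`: `isLocalizationAtPrime_stalkSpecializes`,
`stalkIdeal_map_stalkSpecializes`). OURS; NOT a statement of H. Hironaka's 2017 manuscript; AI-written, weaker than expert review.
No `sorry`; standard axioms; DEF-FREE. `--supports stmt-ResolutionOfSingularities-20148 --as helper`.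

ROUTE (= the (A′-3) downstairs package …NatTransversalTraceDownstairs, p609802): at a special point `x = jG g`, `g ∈ E ∩ F`, the surjection `jG♯_g` has kernel
`(p)`, `p` the germ of the uniformiser (`stalkMap_model_surjective` / `ker_stalkMap_model_le` / `stalkMap_model_varpi`); with `𝓔_x = (e)`, `𝓕_x = (f)`:
`𝒪_{X,x}/(e, f, p) ≅ 𝒪_{G,g}/(𝓘⟨E⟩_g + 𝓘⟨F⟩_g) = 𝒪_{G,g}/𝓘⟨E ∩ F⟩_g` ((W1)), REGULAR ((W2)) of dimension `dim 𝒪_{X,x} − 3` (`hWdim`); res-L1-w45b-lead-1's (A″-0)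
`isRegularLocalRing_quotient_span_pair_of_quotient_triple` (…NatBoundaryWitnessedCentreCore) ⟹ `𝒪_{X,x}/(e, f)` regular and `p`-torsion-free; then
`Scheme.isRegular_subscheme_of_forall_over_closedPoint` (…NatRegularOfSpecialFibre) and `CILift.flat_subschemeι_comp_of_forall_stalk`
(…NatCompleteIntersectionLiftCentre). [cite: Matsumura1987, Thm. 14.2] [cite: Hartshorne1977, III Prop. 9.7] [cite: Liu2002, Thm. 8.1.19]
-/

set_option linter.dupNamespace false
set_option linter.overlappingInstances false -- the binders carry `[IsDomain O] [IsDiscreteValuationRing O]`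

noncomputable section

open CategoryTheory CategoryTheory.Limits AlgebraicGeometry TopologicalSpace Topology IsLocalRing
open Literature.AlgebraicGeometry.Resolution
open AlgebraicGeometry.Scheme.IdealSheafData
open Summit.ResolutionOfSingularities.ResolutionOfSingularities.Cruxes.EquisingularLift.StrataSplit (stalkMap_Γgerm_apply')

namespace Summit.ResolutionOfSingularities.ResolutionOfSingularities.Cruxes.EquisingularLiftNat.Sections

section Transfer

/-- **Torsion-freeness modulo an ideal passes to localisations**: if `p` is a non-zero-divisor on `R ⧸ I` then its image is one on
`S ⧸ IS` for any localisation `S` of `R`. [folklore] [OURS · T23-A″ generisation tool] -/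
theorem mul_mem_imp_mem_map_of_isLocalization {R S : Type*} [CommRing R] [CommRing S] [Algebra R S]
    (M : Submonoid R) [IsLocalization M S] (I : Ideal R) (p : R) (h : ∀ a : R, p * a ∈ I → a ∈ I)
    (b : S) (hb : algebraMap R S p * b ∈ I.map (algebraMap R S)) : b ∈ I.map (algebraMap R S) := by
  obtain ⟨a, s, rfl⟩ := IsLocalization.mk'_surjective M b
  rw [IsLocalization.mul_mk'_eq_mk'_of_mul, IsLocalization.mk'_mem_map_algebraMap_iff M S] at hb
  obtain ⟨m, hm, hma⟩ := hb
  rw [IsLocalization.mk'_mem_map_algebraMap_iff M S]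
  exact ⟨m, hm, h _ (by rw [mul_left_comm]; exact hma)⟩

/-- **`ϖ`-torsion-freeness of `𝒪_{X,x} ⧸ C_x` generises**: along `x ⤳ x₀`, if `p₀` is a non-zero-divisor on `𝒪_{X,x₀} ⧸ C_{x₀}` then its
image in `𝒪_{X,x}` is one on `𝒪_{X,x} ⧸ C_x` (`𝒪_{X,x}` is a localisation of `𝒪_{X,x₀}`, Stacks 01J7, and `C_x = C_{x₀}·𝒪_{X,x}`).
[cite: StacksProject, Tag 01J7] [OURS · T23-A″ generisation tool] -/
theorem mul_mem_stalkIdeal_imp_of_specializes {Y : Scheme.{0}} (C : Y.IdealSheafData) {x x₀ : Y} (hsp : x ⤳ x₀)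
    (p₀ : Y.presheaf.stalk x₀) (h : ∀ a, p₀ * a ∈ stalkIdeal C x₀ → a ∈ stalkIdeal C x₀)
    (b : Y.presheaf.stalk x) (hb : (Y.presheaf.stalkSpecializes hsp).hom p₀ * b ∈ stalkIdeal C x) :
    b ∈ stalkIdeal C x := by
  letI := (Y.presheaf.stalkSpecializes hsp).hom.toAlgebra
  haveI := isLocalizationAtPrime_stalkSpecializes hsp
  rw [← stalkIdeal_map_stalkSpecializes C hsp] at hb ⊢
  exact mul_mem_imp_mem_map_of_isLocalization
    ((maximalIdeal (Y.presheaf.stalk x)).comap (Y.presheaf.stalkSpecializes hsp).hom).primeCompl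
    (stalkIdeal C x₀) p₀ h b hb

/-- **Closed points of a universally closed `O`-scheme lie over the closed point** (`O` local): the image of a closed point under a
closed map is a closed point of `Spec O`, and `𝔪_O` is the only one. [folklore] [OURS · T23-A″ generisation tool] -/
theorem apply_eq_closedPoint_of_isClosed_singleton {A : Type} [CommRing A] [IsLocalRing A] {Y : Scheme.{0}}
    (f : Y ⟶ Spec (.of A)) [UniversallyClosed f] (c : Y) (hc : IsClosed ({c} : Set Y)) :
    f c = closedPoint A := by
  have h1 : IsClosed ({f c} : Set (Spec (.of A))) := by
    rw [← Set.image_singleton]; exact f.isClosedMap _ hc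
  have h3 : closedPoint A ∈ closure ({f c} : Set (Spec (.of A))) :=
    specializes_iff_mem_closure.mp (IsLocalRing.specializes_closedPoint (f c))
  rw [h1.closure_eq] at h3
  exact (Set.eq_of_mem_singleton h3).symm

end Transfer

section A2

variable {O : Type} [CommRing O] [IsDomain O] [IsDiscreteValuationRing O] {k : Type} [Field k] {θ : O →+* k}
  {P : Scheme.{0}} {q : P ⟶ Spec (.of O)}
  {G X : Scheme.{0}} {σ : X ⟶ P} {jG : G ⟶ X} {tG : G ⟶ Spec (.of k)}
  {𝓔 𝓕 : X.IdealSheafData} {E F : Set G} {hE : IsClosed E} {hF : IsClosed F}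

/-- **Special points of `V(𝓔 ⊔ 𝓕)` are crossing points**: a point of `supp (𝓔 ⊔ 𝓕)` over `𝔪_O` is `jG g` with `g ∈ E ∩ F`, and `g` is closed
when the point is. [folklore] [OURS · T23-A″] -/
theorem exists_crossing_point_of_special (hsq : IsPullback jG tG (σ ≫ q) (Spec.map (CommRingCat.ofHom θ))) (hθ : Function.Surjective θ)
    (hE1 : 𝓔.comap jG = vanishingIdeal ⟨E, hE⟩) (hF1 : 𝓕.comap jG = vanishingIdeal ⟨F, hF⟩)
    {x : X} (hx : x ∈ (𝓔 ⊔ 𝓕).support) (hxs : (σ ≫ q) x = closedPoint O) (hxcl : IsClosed ({x} : Set X)) :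
    ∃ g : G, jG g = x ∧ g ∈ E ∩ F ∧ IsClosed ({g} : Set G) := by
  haveI : IsClosedImmersion (Spec.map (CommRingCat.ofHom θ)) := IsClosedImmersion.spec_of_surjective _ hθ
  haveI : IsClosedImmersion jG := MorphismProperty.IsStableUnderBaseChange.of_isPullback hsq.flip inferInstance
  have hrange : Set.range jG = (σ ≫ q) ⁻¹' {closedPoint O} := by
    rw [range_eq_preimage_of_isPullback hsq, range_specMap_of_surjective_of_field θ hθ]
  have hxr : x ∈ Set.range jG := by rw [hrange]; exact hxs
  obtain ⟨g, rfl⟩ := hxr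
  refine ⟨g, rfl, ?_, ?_⟩
  · have hE' : jG g ∈ 𝓔.support := Scheme.IdealSheafData.support_antitone le_sup_left hx
    have hF' : jG g ∈ 𝓕.support := Scheme.IdealSheafData.support_antitone le_sup_right hx
    have h1 : g ∈ ((𝓔.comap jG).support : Set G) := by rw [Scheme.IdealSheafData.support_comap]; exact hE'
    have h2 : g ∈ ((𝓕.comap jG).support : Set G) := by rw [Scheme.IdealSheafData.support_comap]; exact hF'
    rw [hE1, Scheme.IdealSheafData.coe_support_vanishingIdeal] at h1
    rw [hF1, Scheme.IdealSheafData.coe_support_vanishingIdeal] at h2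
    exact ⟨h1, h2⟩
  · have heq : ({g} : Set G) = jG ⁻¹' {jG g} := by
      ext g'
      simp only [Set.mem_singleton_iff, Set.mem_preimage]
      exact jG.isClosedEmbedding.injective.eq_iff.symm
    rw [heq]; exact hxcl.preimage jG.continuous

/-- **The local package of the boundary-witnessed centre at a CLOSED special crossing point** `x = jG g`, `g ∈ E ∩ F` closed:
`𝒪_{X,x}/(𝓔 ⊔ 𝓕)_x` is a regular local ring and the uniformiser germ is `(𝓔 ⊔ 𝓕)_x`-regular — `jG♯_x` is onto with kernel `(ϖ)`, so
`𝒪_{X,x}/(e, f, ϖ) ≅ 𝒪_{G,g}/𝓘⟨E ∩ F⟩_g` (`hW1`) is regular (`hW2`) of dimension `dim 𝒪_{X,x} − 3` (`hWdim`), and res-L1-w45b-lead-1's (A″-0)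
`isRegularLocalRing_quotient_span_pair_of_quotient_triple` applies. [cite: Matsumura1987, Thm. 14.2] [OURS · T23-A″ (A″-1)/(A″-2) local] -/
theorem boundaryWitnessed_local_package [IsLocallyNoetherian X] (hXreg : Scheme.IsRegular X)
    (hsq : IsPullback jG tG (σ ≫ q) (Spec.map (CommRingCat.ofHom θ))) (hθ : Function.Surjective θ) (ϖ : O) (hϖ : Irreducible ϖ)
    (hE1 : 𝓔.comap jG = vanishingIdeal ⟨E, hE⟩) (hE2 : ∀ x : X, (stalkIdeal 𝓔 x).IsPrincipal)
    (hF1 : 𝓕.comap jG = vanishingIdeal ⟨F, hF⟩) (hF2 : ∀ x : X, (stalkIdeal 𝓕 x).IsPrincipal)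
    (hW1 : vanishingIdeal (⟨E, hE⟩ : Closeds G) ⊔ vanishingIdeal (⟨F, hF⟩ : Closeds G) = vanishingIdeal ⟨E ∩ F, hE.inter hF⟩)
    (hW2 : ∀ z : ↥(vanishingIdeal (⟨E ∩ F, hE.inter hF⟩ : Closeds G)).subscheme,
      IsRegularLocalRing ((vanishingIdeal (⟨E ∩ F, hE.inter hF⟩ : Closeds G)).subscheme.presheaf.stalk z))
    (hWdim : ∀ g ∈ E ∩ F, IsClosed ({g} : Set G) →
      ringKrullDim (G.presheaf.stalk g ⧸ stalkIdeal (vanishingIdeal (⟨E ∩ F, hE.inter hF⟩ : Closeds G)) g) + 3 =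
        ringKrullDim (X.presheaf.stalk (jG g)))
    (g : G) (hg : g ∈ E ∩ F) (hgcl : IsClosed ({g} : Set G)) :
    IsRegularLocalRing (X.presheaf.stalk (jG g) ⧸ stalkIdeal (𝓔 ⊔ 𝓕) (jG g)) ∧
      ∀ a : X.presheaf.stalk (jG g),
        (X.presheaf.Γgerm (jG g)).hom ((σ ≫ q).appTop.hom ((Scheme.ΓSpecIso (.of O)).inv.hom ϖ)) * a ∈ stalkIdeal (𝓔 ⊔ 𝓕) (jG g) →
        a ∈ stalkIdeal (𝓔 ⊔ 𝓕) (jG g) := by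
  classical
  haveI : IsRegularLocalRing (X.presheaf.stalk (jG g)) := hXreg (jG g)
  haveI : IsClosedImmersion (Spec.map (CommRingCat.ofHom θ)) := IsClosedImmersion.spec_of_surjective _ hθ
  haveI : IsClosedImmersion jG := MorphismProperty.IsStableUnderBaseChange.of_isPullback hsq.flip inferInstance
  haveI : IsLocallyNoetherian G := LocallyOfFiniteType.isLocallyNoetherian jG
  set p := (X.presheaf.Γgerm (jG g)).hom ((σ ≫ q).appTop.hom ((Scheme.ΓSpecIso (.of O)).inv.hom ϖ)) with hp
  have hφs : Function.Surjective (jG.stalkMap g).hom := stalkMap_model_surjective θ hθ (σ ≫ q) jG tG hsq g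
  have hφp : (jG.stalkMap g).hom p = 0 :=
    stalkMap_model_varpi θ hθ (σ ≫ q) jG tG hsq g ϖ (hϖ.maximalIdeal_eq ▸ Ideal.mem_span_singleton_self ϖ)
  have hker : RingHom.ker (jG.stalkMap g).hom = Ideal.span {p} := by
    refine le_antisymm (ker_stalkMap_model_le O k θ hθ (σ ≫ q) jG tG hsq g ϖ hϖ) ?_
    rw [Ideal.span_le, Set.singleton_subset_iff]; exact hφp
  -- generators `e`, `f`
  obtain ⟨e, he⟩ := (hE2 (jG g)).principal
  obtain ⟨f, hf⟩ := (hF2 (jG g)).principal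
  have he' : stalkIdeal 𝓔 (jG g) = Ideal.span {e} := by rw [he, Ideal.submodule_span_eq]
  have hf' : stalkIdeal 𝓕 (jG g) = Ideal.span {f} := by rw [hf, Ideal.submodule_span_eq]
  have hsupx : stalkIdeal (𝓔 ⊔ 𝓕) (jG g) = Ideal.span ({e, f} : Set (X.presheaf.stalk (jG g))) := by
    rw [stalkIdeal_sup, he', hf', Ideal.span_insert]
  -- `(W1)` at the stalk: `𝓘⟨E⟩_g + 𝓘⟨F⟩_g = 𝓘⟨E ∩ F⟩_g`
  have hW1g : stalkIdeal (vanishingIdeal (⟨E, hE⟩ : Closeds G)) g ⊔ stalkIdeal (vanishingIdeal (⟨F, hF⟩ : Closeds G)) g =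
      stalkIdeal (vanishingIdeal (⟨E ∩ F, hE.inter hF⟩ : Closeds G)) g := by
    rw [← stalkIdeal_sup, hW1]
  -- `(e) + (f)` pushes forward to `𝓘⟨E ∩ F⟩_g`
  have hmapEF : (stalkIdeal (𝓔 ⊔ 𝓕) (jG g)).map (jG.stalkMap g).hom =
      stalkIdeal (vanishingIdeal (⟨E ∩ F, hE.inter hF⟩ : Closeds G)) g := by
    rw [stalkIdeal_sup, Ideal.map_sup, ← stalkIdeal_comap_eq_map_stalkMap, ← stalkIdeal_comap_eq_map_stalkMap, hE1, hF1]
    exact hW1g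
  -- the triple ideal and the iso `𝒪_{X,x}/(e, f, p) ≅ 𝒪_{G,g}/𝓘⟨E ∩ F⟩_g`
  have htriple : Ideal.span ({e, f, p} : Set (X.presheaf.stalk (jG g))) =
      stalkIdeal (𝓔 ⊔ 𝓕) (jG g) ⊔ RingHom.ker (jG.stalkMap g).hom := by
    rw [hsupx, hker, Ideal.span_insert, Ideal.span_insert, Ideal.span_insert, sup_assoc]
  have hψs : Function.Surjective
      ((Ideal.Quotient.mk (stalkIdeal (vanishingIdeal (⟨E ∩ F, hE.inter hF⟩ : Closeds G)) g)).comp (jG.stalkMap g).hom) :=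
    Ideal.Quotient.mk_surjective.comp hφs
  have hkerψ : RingHom.ker
      ((Ideal.Quotient.mk (stalkIdeal (vanishingIdeal (⟨E ∩ F, hE.inter hF⟩ : Closeds G)) g)).comp (jG.stalkMap g).hom) =
      Ideal.span ({e, f, p} : Set (X.presheaf.stalk (jG g))) := by
    rw [← RingHom.comap_ker, Ideal.mk_ker, ← hmapEF, Ideal.comap_map_of_surjective _ hφs, ← RingHom.ker_eq_comap_bot, htriple]
  have eψ : X.presheaf.stalk (jG g) ⧸ Ideal.span ({e, f, p} : Set (X.presheaf.stalk (jG g))) ≃+*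
      G.presheaf.stalk g ⧸ stalkIdeal (vanishingIdeal (⟨E ∩ F, hE.inter hF⟩ : Closeds G)) g :=
    (Ideal.quotEquivOfEq hkerψ.symm).trans (RingHom.quotientKerEquivOfSurjective hψs)
  -- the target is regular (`hW2`) of dimension `dim − 3` (`hWdim`)
  have hgZ : g ∈ (vanishingIdeal (⟨E ∩ F, hE.inter hF⟩ : Closeds G)).support := by
    show g ∈ ((vanishingIdeal (⟨E ∩ F, hE.inter hF⟩ : Closeds G)).support : Set G)
    rw [Scheme.IdealSheafData.coe_support_vanishingIdeal]; exact hg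
  haveI hZreg : IsRegularLocalRing (G.presheaf.stalk g ⧸ stalkIdeal (vanishingIdeal (⟨E ∩ F, hE.inter hF⟩ : Closeds G)) g) :=
    isRegularLocalRing_stalk_quotient_stalkIdeal hW2 hgZ
  haveI : IsRegularLocalRing (X.presheaf.stalk (jG g) ⧸ Ideal.span ({e, f, p} : Set (X.presheaf.stalk (jG g)))) :=
    IsRegularLocalRing.of_ringEquiv eψ.symm
  have hdim : ringKrullDim (X.presheaf.stalk (jG g) ⧸ Ideal.span ({e, f, p} : Set (X.presheaf.stalk (jG g)))) + 3 =
      ringKrullDim (X.presheaf.stalk (jG g)) := by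
    rw [ringKrullDim_eq_of_ringEquiv eψ]; exact hWdim g hg hgcl
  -- `e, f, p ∈ 𝔪`
  have hxE : jG g ∈ 𝓔.support := by
    have h1 : g ∈ ((𝓔.comap jG).support : Set G) := by
      rw [hE1, Scheme.IdealSheafData.coe_support_vanishingIdeal]; exact hg.1
    rwa [Scheme.IdealSheafData.support_comap] at h1
  have hxF : jG g ∈ 𝓕.support := by
    have h1 : g ∈ ((𝓕.comap jG).support : Set G) := by
      rw [hF1, Scheme.IdealSheafData.coe_support_vanishingIdeal]; exact hg.2
    rwa [Scheme.IdealSheafData.support_comap] at h1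
  have hem : e ∈ maximalIdeal _ :=
    (mem_support_iff_stalkIdeal_le _ _).mp hxE (he'.symm ▸ Ideal.mem_span_singleton_self e)
  have hfm : f ∈ maximalIdeal _ :=
    (mem_support_iff_stalkIdeal_le _ _).mp hxF (hf'.symm ▸ Ideal.mem_span_singleton_self f)
  have hpm : p ∈ maximalIdeal _ := by
    rw [← IsLocalRing.eq_maximalIdeal
      (Ideal.comap_isMaximal_of_surjective (jG.stalkMap g).hom hφs (K := maximalIdeal (G.presheaf.stalk g))),
      Ideal.mem_comap, hφp]
    exact zero_mem _
  -- (A″-0)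
  obtain ⟨hreg, hnzd⟩ := isRegularLocalRing_quotient_span_pair_of_quotient_triple e f p hem hfm hpm hdim
  refine ⟨?_, fun a ha => ?_⟩
  · rw [hsupx]; exact hreg
  · rw [hsupx] at ha ⊢
    have h0 : Ideal.Quotient.mk (Ideal.span ({e, f} : Set (X.presheaf.stalk (jG g)))) p *
        Ideal.Quotient.mk (Ideal.span ({e, f} : Set (X.presheaf.stalk (jG g)))) a = 0 := by
      rw [← map_mul, Ideal.Quotient.eq_zero_iff_mem]; exact ha
    exact Ideal.Quotient.eq_zero_iff_mem.mp (hnzd _ h0)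

/-- **(A″-1) v2 — the boundary-witnessed centre `V(𝓔 ⊔ 𝓕)` is REGULAR.** res-L1-w45b-lead-1's SIG 007c6321fc326192 brick in the ENGINE-WORD
shape (`hW1` global, `hW2` stalkwise on the reduced crossing scheme, `hWdim` at closed crossing points); regularity at an arbitrary point of the
proper `O`-scheme `V(𝓔 ⊔ 𝓕)` follows from regularity at a closed specialisation, which lies over `𝔪_O` and is `jG g`, `g ∈ E ∩ F` closed.
[cite: Matsumura1987, Thm. 14.2] [OURS · L1 W4.5b · T23-A″ (A″-1)] toward the B″-residues of stmt-ResolutionOfSingularities-20148; NOT a statement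
of the manuscript. -/
theorem isRegular_subscheme_sup_of_trace_crossing [IsLocallyNoetherian X] (hXreg : Scheme.IsRegular X)
    (hsq : IsPullback jG tG (σ ≫ q) (Spec.map (CommRingCat.ofHom θ))) (hθ : Function.Surjective θ) [IsProper (σ ≫ q)]
    (hE1 : 𝓔.comap jG = vanishingIdeal ⟨E, hE⟩) (hE2 : ∀ x : X, (stalkIdeal 𝓔 x).IsPrincipal)
    (hF1 : 𝓕.comap jG = vanishingIdeal ⟨F, hF⟩) (hF2 : ∀ x : X, (stalkIdeal 𝓕 x).IsPrincipal)
    (hW1 : vanishingIdeal (⟨E, hE⟩ : Closeds G) ⊔ vanishingIdeal (⟨F, hF⟩ : Closeds G) = vanishingIdeal ⟨E ∩ F, hE.inter hF⟩)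
    (hW2 : ∀ z : ↥(vanishingIdeal (⟨E ∩ F, hE.inter hF⟩ : Closeds G)).subscheme,
      IsRegularLocalRing ((vanishingIdeal (⟨E ∩ F, hE.inter hF⟩ : Closeds G)).subscheme.presheaf.stalk z))
    (hWdim : ∀ g ∈ E ∩ F, IsClosed ({g} : Set G) →
      ringKrullDim (G.presheaf.stalk g ⧸ stalkIdeal (vanishingIdeal (⟨E ∩ F, hE.inter hF⟩ : Closeds G)) g) + 3 =
        ringKrullDim (X.presheaf.stalk (jG g))) :
    Scheme.IsRegular (𝓔 ⊔ 𝓕).subscheme := by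
  classical
  obtain ⟨ϖ, hϖ⟩ := IsDiscreteValuationRing.exists_irreducible O
  haveI : CompactSpace ↥(Spec (CommRingCat.of O)) := inferInstanceAs (CompactSpace (PrimeSpectrum O))
  haveI : CompactSpace ↥(𝓔 ⊔ 𝓕).subscheme := QuasiCompact.compactSpace_of_compactSpace ((𝓔 ⊔ 𝓕).subschemeι ≫ σ ≫ q)
  intro s
  obtain ⟨s₀, hs₀, hcl⟩ :=
    (isClosed_closure (s := ({s} : Set ↥(𝓔 ⊔ 𝓕).subscheme))).exists_closed_singleton ⟨s, subset_closure rfl⟩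
  have hsp : s ⤳ s₀ := specializes_iff_mem_closure.mpr hs₀
  refine isRegularLocalRing_stalk_of_specializes hsp ?_
  rw [isRegularLocalRing_stalk_subscheme_iff]
  -- the closed point `x₀ = ι s₀` of `X` is special and lies on `supp (𝓔 ⊔ 𝓕)`
  have hx₀cl : IsClosed ({(𝓔 ⊔ 𝓕).subschemeι.base s₀} : Set X) := by
    rw [← Set.image_singleton]; exact (𝓔 ⊔ 𝓕).subschemeι.isClosedMap _ hcl
  have hx₀s : (σ ≫ q) ((𝓔 ⊔ 𝓕).subschemeι.base s₀) = closedPoint O := by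
    have h := apply_eq_closedPoint_of_isClosed_singleton ((𝓔 ⊔ 𝓕).subschemeι ≫ σ ≫ q) s₀ hcl
    rwa [Scheme.Hom.comp_apply] at h
  have hx₀supp : (𝓔 ⊔ 𝓕).subschemeι.base s₀ ∈ (𝓔 ⊔ 𝓕).support := by
    show (𝓔 ⊔ 𝓕).subschemeι.base s₀ ∈ ((𝓔 ⊔ 𝓕).support : Set X)
    rw [← Scheme.IdealSheafData.range_subschemeι]; exact Set.mem_range_self s₀
  obtain ⟨g₀, hg₀, hg₀EF, hg₀cl⟩ := exists_crossing_point_of_special hsq hθ hE1 hF1 hx₀supp hx₀s hx₀cl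
  rw [← hg₀]
  exact (boundaryWitnessed_local_package hXreg hsq hθ ϖ hϖ hE1 hE2 hF1 hF2 hW1 hW2 hWdim g₀ hg₀EF hg₀cl).1

/-- **(A″-2) v2 — the boundary-witnessed centre `V(𝓔 ⊔ 𝓕)` is `O`-FLAT.** res-L1-w45b-lead-1's SIG 007c6321fc326192 brick in the ENGINE-WORD shape,
WITH the dimension clause `hWdim` (without it the statement is false: `𝓔 = (x)`, `𝓕 = (x + ϖ)`). Flat = `ϖ`-torsion-free on the special stalks
(`CILift.flat_subschemeι_comp_of_forall_stalk`); at a special point `x ∈ supp (𝓔 ⊔ 𝓕)` take a closed specialisation `x ⤳ x₀ = jG g₀`: `ϖ` is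
`(e, f)`-regular at `x₀` by the local package and this generises (`mul_mem_stalkIdeal_imp_of_specializes`). [cite: Hartshorne1977, III Prop. 9.7]
[cite: Matsumura1987, Thm. 14.2] [OURS · L1 W4.5b · T23-A″ (A″-2)] toward the B″-residues of stmt-ResolutionOfSingularities-20148; NOT a statement
of the manuscript. -/
theorem flat_subschemeι_sup_of_trace_crossing [IsLocallyNoetherian X] (hXreg : Scheme.IsRegular X)
    (hsq : IsPullback jG tG (σ ≫ q) (Spec.map (CommRingCat.ofHom θ))) (hθ : Function.Surjective θ) [IsProper (σ ≫ q)]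
    (hE1 : 𝓔.comap jG = vanishingIdeal ⟨E, hE⟩) (hE2 : ∀ x : X, (stalkIdeal 𝓔 x).IsPrincipal)
    (hF1 : 𝓕.comap jG = vanishingIdeal ⟨F, hF⟩) (hF2 : ∀ x : X, (stalkIdeal 𝓕 x).IsPrincipal)
    (hW1 : vanishingIdeal (⟨E, hE⟩ : Closeds G) ⊔ vanishingIdeal (⟨F, hF⟩ : Closeds G) = vanishingIdeal ⟨E ∩ F, hE.inter hF⟩)
    (hW2 : ∀ z : ↥(vanishingIdeal (⟨E ∩ F, hE.inter hF⟩ : Closeds G)).subscheme,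
      IsRegularLocalRing ((vanishingIdeal (⟨E ∩ F, hE.inter hF⟩ : Closeds G)).subscheme.presheaf.stalk z))
    (hWdim : ∀ g ∈ E ∩ F, IsClosed ({g} : Set G) →
      ringKrullDim (G.presheaf.stalk g ⧸ stalkIdeal (vanishingIdeal (⟨E ∩ F, hE.inter hF⟩ : Closeds G)) g) + 3 =
        ringKrullDim (X.presheaf.stalk (jG g))) :
    Flat ((𝓔 ⊔ 𝓕).subschemeι ≫ σ ≫ q) := by
  classical
  obtain ⟨ϖ, hϖ⟩ := IsDiscreteValuationRing.exists_irreducible O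
  haveI : CompactSpace ↥(Spec (CommRingCat.of O)) := inferInstanceAs (CompactSpace (PrimeSpectrum O))
  haveI : CompactSpace ↥X := QuasiCompact.compactSpace_of_compactSpace (σ ≫ q)
  refine CILift.flat_subschemeι_comp_of_forall_stalk O (σ ≫ q) (𝓔 ⊔ 𝓕) ϖ hϖ fun x hx hxs => ?_
  -- a closed specialisation `x ⤳ x₀` in `X`; it stays on `supp (𝓔 ⊔ 𝓕)` and over `𝔪_O`
  obtain ⟨x₀, hx₀, hcl⟩ := (isClosed_closure (s := ({x} : Set ↥X))).exists_closed_singleton ⟨x, subset_closure rfl⟩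
  have hsp : x ⤳ x₀ := specializes_iff_mem_closure.mpr hx₀
  have hx₀supp : x₀ ∈ (𝓔 ⊔ 𝓕).support := by
    have hsub : closure ({x} : Set ↥X) ⊆ ((𝓔 ⊔ 𝓕).support : Set X) :=
      (𝓔 ⊔ 𝓕).support.isClosed.closure_subset_iff.mpr (Set.singleton_subset_iff.mpr hx)
    exact hsub hx₀
  have hx₀s : (σ ≫ q) x₀ = closedPoint O := apply_eq_closedPoint_of_isClosed_singleton (σ ≫ q) x₀ hcl
  obtain ⟨g₀, rfl, hg₀EF, hg₀cl⟩ := exists_crossing_point_of_special hsq hθ hE1 hF1 hx₀supp hx₀s hcl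
  have h2 := (boundaryWitnessed_local_package hXreg hsq hθ ϖ hϖ hE1 hE2 hF1 hF2 hW1 hW2 hWdim g₀ hg₀EF hg₀cl).2
  -- the uniformiser germ at `x` is the specialisation of the one at `x₀`
  have hpx : (X.presheaf.stalkSpecializes hsp).hom
      ((X.presheaf.Γgerm (jG g₀)).hom ((σ ≫ q).appTop.hom ((Scheme.ΓSpecIso (.of O)).inv.hom ϖ))) =
      (X.presheaf.Γgerm x).hom ((σ ≫ q).appTop.hom ((Scheme.ΓSpecIso (.of O)).inv.hom ϖ)) := by
    rw [← CommRingCat.comp_apply, TopCat.Presheaf.Γgerm, TopCat.Presheaf.germ_stalkSpecializes]; rfl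
  intro a ha
  refine mul_mem_stalkIdeal_imp_of_specializes (𝓔 ⊔ 𝓕) hsp _ h2 a ?_
  rw [hpx]; exact ha

end A2

end Summit.ResolutionOfSingularities.ResolutionOfSingularities.Cruxes.EquisingularLiftNat.Sections

end
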